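import Summits.QuantumFields.YangMills.Theorems.LuscherReductionTwistedTraceScalingRecordBricks
import Summits.QuantumFields.YangMills.Theorems.TwistedTraceScaling.Negative.SupportRecordRadiusThree
import HarnessLib

/-!
# R36b — lane A's `RecordBOInput L s K M` is UNINHABITED unless the fat-radius factor exceeds `3`
# (support-geometry guard, crux `TwistedTraceScaling`, stmt-QuantumFields-20203; corollary of R36 `…Negative.SupportRecordRadiusThree`)

`RecordBOInput L s K M` (`…RecordBricks`, p650161) is what a successor must supply for the record weight `recordChi L s K M = recordWeightRho (Kβ^{-s}) (MKβ^{-s}) β^{-1}`;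
`innerNoIntruderOneOrbitAt_of_recordInput` turns it into C4-CORE(s) for every `K ≥ 1` and `M ≥ M₀`.  Two of its structural fields are `hshadow` (every weighted `U` with
`orbitDist U < β^{-s}` has `orbitDist₁ (slowMean U) < δ₁`) and `hradii` (`|Edge 3 L|·(4r + δ₁) < K·β^{-s}` eventually — the hypothesis of `boFun_support_record`).  By R36
(`three_mul_le_card_mul_delta1`: constant diagonal lifts) `hshadow` forces `|Edge 3 L|·δ₁ ≥ 3β^{-s}`, so `hradii` forces **`K > 3`**: ★ `three_lt_of_recordInput`.  In particular the
weight of the target of record `innerNoIntruderOneOrbitAt_pow_of_bricks` (fat radius `3β^{-s}`, i.e. `K = 3`) is NOT reachable through `RecordBOInput`, and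
`innerNoIntruderOneOrbitAt_of_recordInput` is VACUOUS for `K ∈ [1, 3]`; lane A's `…RecordShadow` (p651108: `δ₁ = 14β^{-s}/L³`, `K > 42`) is consistent with this.  With the sharp
fibre bound `R36.orbitDist_orthoTube_le_sharp` in place of `orbitDist_orthoTube_le` the same shadow radius would need only `K > 14`; with the necessary-and-sufficient shadow
radius `≈ 3β^{-s}/|Edge|` only `K > 1`.  (R34: the fat parameters are decorative for the TARGET; they are not for the offered DISCHARGE.)
HONEST FRAMING: a necessary condition on the parameters of lane A's input structure; refutes no registered statement, not `RecordBOInput` for `K > 3`, not C4; stub of a child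
of the CONDITIONAL reduction route R2b1; not a gap, not Clay.
-/

set_option autoImplicit false

noncomputable section

open MeasureTheory Filter Topology Real
open scoped BigOperators
open Literature.MathematicalPhysics.QuantumFieldTheory hiding SU2
open Literature.MathematicalPhysics.QuantumLattice

namespace Summit.QuantumFields.YangMills.Theorems.TwistedTraceScaling.Negative.R36b

open Summit.QuantumFields.YangMills.Theorems.FemtoTransferGap
open Summit.QuantumFields.YangMills.Theorems.FemtoTransferGap.TwoLattice.Avg
open Summit.QuantumFields.YangMills.Theorems.FemtoTransferGap.TwoLattice.ConstTube
open Summit.QuantumFields.YangMills.Theorems.TwistedTraceScaling.Negative.R36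

variable {L : ℕ} [NeZero L]

/-- ★ **R36b-1.**  The shadow field of `RecordBOInput` alone forces `3·β^{-s} ≤ |Edge 3 L|·δ₁ β` eventually (`s ≥ 0`, `K ≥ 1`, `MK ≥ 1`). [folklore] -/
theorem three_mul_powScale_le_of_recordInput {s K M : ℝ} (hs : 0 ≤ s) (hK : 1 ≤ K) (hMK : 1 ≤ M * K) (I : RecordBOInput L s K M) :
    ∀ᶠ β in atTop, 3 * powScale s β ≤ Fintype.card (Edge 3 L) * I.δ₁ β := by
  filter_upwards [I.hshadow] with β hsh
  have hp : 0 < powScale s β := by unfold powScale; positivity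
  refine three_mul_le_card_mul_delta1 (L := L) (δ' := fun β => K * powScale s β) (ρ := fun b => M * (K * powScale s b)) (δg := powScale 1)
    (𝒰 := {u | orbitDist u < I.δ₁ β}) hp (powScale_le_one hs β) (by show powScale s β ≤ K * powScale s β; nlinarith)
    (by show powScale s β ≤ M * (K * powScale s β); nlinarith) (fun u hu => hu) ?_
  intro U hU hd
  exact hsh U hU hd

/-- ★ **R36b-2.**  Hence `RecordBOInput L s K M` is uninhabited unless `K > 3` (`s ≥ 0`, `K ≥ 1`, `MK ≥ 1`): the fat-radius factor `K = 3` of the target-of-record weight is out of reach of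
`boFun_support_record`. [folklore] -/
theorem three_lt_of_recordInput {s K M : ℝ} (hs : 0 ≤ s) (hK : 1 ≤ K) (hMK : 1 ≤ M * K) (I : RecordBOInput L s K M) : 3 < K := by
  obtain ⟨β, h3, hrad⟩ := ((three_mul_powScale_le_of_recordInput hs hK hMK I).and I.hradii).exists
  have hp : 0 < powScale s β := by unfold powScale; positivity
  have hr : 0 ≤ I.r β := (I.hr β).1
  have hN : (0 : ℝ) ≤ Fintype.card (Edge 3 L) := Nat.cast_nonneg _
  have h1 : (Fintype.card (Edge 3 L) : ℝ) * I.δ₁ β ≤ Fintype.card (Edge 3 L) * (4 * I.r β + I.δ₁ β) := by nlinarith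
  have h2 : 3 * powScale s β < K * powScale s β := by linarith
  exact lt_of_mul_lt_mul_right h2 hp.le

/-- R36b-3.  `RecordBOInput L s K M` is empty for `1 ≤ K ≤ 3` (`s ≥ 0`, `MK ≥ 1`). [folklore] -/
theorem isEmpty_recordInput_of_le_three {s K M : ℝ} (hs : 0 ≤ s) (hK : 1 ≤ K) (hK3 : K ≤ 3) (hMK : 1 ≤ M * K) : IsEmpty (RecordBOInput L s K M) :=
  ⟨fun I => absurd (three_lt_of_recordInput hs hK hMK I) (not_lt.mpr hK3)⟩

end Summit.QuantumFields.YangMills.Theorems.TwistedTraceScaling.Negative.R36b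

end
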